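import Mathlib
import Literature.Computability.AlgebraicComplexity.MignonRessayreBound
import Summits.ValiantsHypothesis.ValiantsHypothesis.Theorems.GrenetZeonTwoDimCoefficientsDefs
import Summits.ValiantsHypothesis.ValiantsHypothesis.Theorems.GrenetZeonTwoDimCoefficientsDualUnipotentCalibration

/-!
# Crux `GrenetZeon.TwoDimCoefficients` (stmt-ValiantsHypothesis-8062), stub `stub_dualUnipotent`:
# the bound interpolates in the rank of the direction `B`

`GrenetZeonTwoDimCoefficientsDualUnipotentCalibration` proves the stub's bound in two extreme cases of
the unipotent dual representation `per_n = α det A + β tr(adj A·B)`, `det A ≡ c ≠ 0`: a rank-one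
direction `B = u(x)·vᵀ` gives `n² ≤ 2(m + 1)` and an arbitrary affine `B` gives `n² ≤ 2(m² + 1)`.
This file proves the common generalisation: if the affine direction factors as `B = U(x)·V₀` through
a CONSTANT `r × m` matrix `V₀` (equivalently: the rows of all `B(x)` lie in a fixed `r`-dimensional
space), then `per_n` is ONE affine determinant of size `r·m + 1`,

  `per_n = det [[α c^{1−r}, −β c^{1−r}·vec(V₀ᵀ)ᵀ], [vec U, diag(A, …, A)]]`   (`r` copies of `A`),

so Mignon–Ressayre gives `n² ≤ 2(r·m + 1)` (`sq_le_of_dualUnipotentRepr_rank`).  At `r = m`,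
`V₀ = 1`, `U = B` this is the `m² + 1` transfer; at `r = 1` it is the rank-one case (there even
without the hypothesis on `det A`).  So `DualUnipotentBound` HOLDS on every sub-family of bounded
direction rank `r ≤ r₀` (with `C = 2r₀ + 2`); the open content of the stub is exactly the regime
`r → ∞` (e.g. `r = m`), where the model contains the traces of iterated matrix products and is
pointwise Hessian-blind (`GrenetZeonTwoDimCoefficientsDualUnipotentHessianBlind`).

HONEST FRAMING: constant-size bookkeeping in the quadratic regime; the stub stays open;
`VP ≠ VNP` is not moved.

References: T. Mignon, N. Ressayre, Int. Math. Res. Not. 2004:79, Thm. 1.1;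
L. G. Valiant, Completeness classes in algebra, STOC 1979, §2.
-/

-- single-conjunct layout `Summits/ValiantsHypothesis/ValiantsHypothesis`: the duplicated namespace
-- component is mandated by the tree.
set_option linter.dupNamespace false

noncomputable section

namespace Summit.ValiantsHypothesis.ValiantsHypothesis.Cruxes.TwoDimCoefficients.DimTwoCases

open Literature.Computability.AlgebraicComplexity Matrix MvPolynomial

/-! ### `r` diagonal copies of `A` -/

section Copies

variable {R : Type} [CommRing R] {m r : ℕ}

/-- `det diag(A, …, A) = (det A)^r` (`r` copies). [folklore] -/
theorem det_blockDiagonal_copies (A : Matrix (Fin m) (Fin m) R) :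
    (blockDiagonal fun _ : Fin r => A).det = A.det ^ r := by
  simp [Finset.prod_const, Finset.card_univ]

/-- `adj diag(A, …, A) = diag((det A)^{r−1}·adj A, …)` (`r ≥ 1` copies, `det A` a unit).
[folklore] -/
theorem adjugate_blockDiagonal_copies (A : Matrix (Fin m) (Fin m) R) (hA : IsUnit A.det)
    (hr : 1 ≤ r) :
    (blockDiagonal fun _ : Fin r => A).adjugate =
      blockDiagonal fun _ : Fin r => A.det ^ (r - 1) • A.adjugate := by
  have hD : IsUnit (blockDiagonal fun _ : Fin r => A).det := by
    rw [det_blockDiagonal_copies]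
    exact hA.pow r
  have key : (blockDiagonal fun _ : Fin r => A) *
        blockDiagonal (fun _ : Fin r => A.det ^ (r - 1) • A.adjugate) =
      (blockDiagonal fun _ : Fin r => A) * (blockDiagonal fun _ : Fin r => A).adjugate := by
    rw [mul_adjugate, det_blockDiagonal_copies, ← blockDiagonal_mul]
    have h1 : (fun _ : Fin r => A * (A.det ^ (r - 1) • A.adjugate)) =
        A.det ^ r • (1 : Fin r → Matrix (Fin m) (Fin m) R) := by
      funext i
      rw [Matrix.mul_smul, mul_adjugate, smul_smul, ← pow_succ, Nat.sub_add_cancel hr]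
      rfl
    rw [h1, blockDiagonal_smul, blockDiagonal_one]
  calc (blockDiagonal fun _ : Fin r => A).adjugate
      = (blockDiagonal fun _ : Fin r => A)⁻¹ *
          ((blockDiagonal fun _ : Fin r => A) * (blockDiagonal fun _ : Fin r => A).adjugate) :=
        (Matrix.nonsing_inv_mul_cancel_left _ _ hD).symm
    _ = (blockDiagonal fun _ : Fin r => A)⁻¹ * ((blockDiagonal fun _ : Fin r => A) *
          blockDiagonal fun _ : Fin r => A.det ^ (r - 1) • A.adjugate) := by rw [key]
    _ = blockDiagonal fun _ : Fin r => A.det ^ (r - 1) • A.adjugate :=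
        Matrix.nonsing_inv_mul_cancel_left _ _ hD

/-- The border sum of Cauchy's formula for `[[s, g·vec(V₀ᵀ)ᵀ], [vec U, diag(A,…,A)]]` (`r` copies,
reindexed by `Fin (m·r)`) is `g·(det A)^{r−1}·tr(adj A · U V₀)`. [folklore] -/
theorem border_sum_eq_trace_rank (A : Matrix (Fin m) (Fin m) R) (U : Matrix (Fin m) (Fin r) R)
    (V : Matrix (Fin r) (Fin m) R) (g : R) (hA : IsUnit A.det) (hr : 1 ≤ r) :
    ∑ i : Fin (m * r), ∑ j : Fin (m * r),
        g * V (finProdFinEquiv.symm j).2 (finProdFinEquiv.symm j).1 *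
          ((blockDiagonal fun _ : Fin r => A).submatrix finProdFinEquiv.symm
              finProdFinEquiv.symm).adjugate j i *
          U (finProdFinEquiv.symm i).1 (finProdFinEquiv.symm i).2 =
      g * A.det ^ (r - 1) * (A.adjugate * (U * V)).trace := by
  rw [adjugate_submatrix_equiv_self, adjugate_blockDiagonal_copies A hA hr]
  have step : ∑ i : Fin (m * r), ∑ j : Fin (m * r),
        g * V (finProdFinEquiv.symm j).2 (finProdFinEquiv.symm j).1 *
          (blockDiagonal fun _ : Fin r => A.det ^ (r - 1) • A.adjugate).submatrix
            finProdFinEquiv.symm finProdFinEquiv.symm j i *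
          U (finProdFinEquiv.symm i).1 (finProdFinEquiv.symm i).2 =
      ∑ p : Fin m × Fin r, ∑ q : Fin m × Fin r, g * V q.2 q.1 *
        (blockDiagonal (fun _ : Fin r => A.det ^ (r - 1) • A.adjugate) q p) * U p.1 p.2 := by
    refine Fintype.sum_equiv finProdFinEquiv.symm _ _ fun i => ?_
    exact Fintype.sum_equiv finProdFinEquiv.symm _ _ fun j => rfl
  rw [step]
  simp only [blockDiagonal_apply, Matrix.smul_apply, smul_eq_mul, Fintype.sum_prod_type, mul_ite,
    mul_zero, ite_mul, zero_mul]
  simp only [Finset.sum_ite_eq', Finset.mem_univ, if_true]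
  simp only [Matrix.trace, Matrix.diag_apply, Matrix.mul_apply, Finset.mul_sum]
  -- LHS binders `(a, k, b)`, RHS binders `(b, a, k)`: reorder and compare termwise
  conv_lhs =>
    enter [2, a]
    rw [Finset.sum_comm]
  rw [Finset.sum_comm]
  refine Finset.sum_congr rfl fun b _ => Finset.sum_congr rfl fun a _ =>
    Finset.sum_congr rfl fun k _ => ?_
  ring

end Copies

/-! ### The rank-`r` transfer -/

/-- `per_n` (`n ≥ 1`) is not a constant polynomial. [folklore] -/
theorem perPoly_ne_C {n : ℕ} (hn : 1 ≤ n) (a : ℂ) : perPoly (Fin n) ℂ ≠ MvPolynomial.C a := by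
  intro h0
  haveI : Nonempty (Fin n) := ⟨⟨0, hn⟩⟩
  have e0 := congrArg (MvPolynomial.eval fun _ : Fin n × Fin n => (0 : ℂ)) h0
  have e1 := congrArg (MvPolynomial.eval fun p : Fin n × Fin n => if p.1 = p.2 then (1 : ℂ) else 0) h0
  rw [eval_perPoly, eval_C] at e0 e1
  have hz : (Matrix.of fun _ _ : Fin n => (0 : ℂ)) = 0 := by
    ext i j
    rfl
  have ho : (Matrix.of fun i j : Fin n => if i = j then (1 : ℂ) else 0) = 1 := by
    ext i j
    simp [Matrix.one_apply]
  rw [hz, Matrix.permanent_zero] at e0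
  rw [ho, Matrix.permanent_one] at e1
  exact zero_ne_one (e0.trans e1.symm)

/-- **Rank-`r` transfer.** If `per_n = α·det A + β·tr(adj A · B)` with `A` affine `m × m` of
constant determinant `c ≠ 0` and the direction factors as `B = U·V₀` with `U` an affine `m × r`
matrix and `V₀` a constant `r × m` matrix (entrywise: `B i j = Σ_k U i k · V₀ k j`), then `per_n` has
an affine determinantal representation of size `m·r + 1` (`n ≥ 1`). [folklore] -/
theorem hasDetRepr_of_dualUnipotentRepr_rank {n m r : ℕ} (hn : 1 ≤ n) (α β c : ℂ) (hc : c ≠ 0)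
    (A B : AffMat n m) (U : Matrix (Fin m) (Fin r) (MvPolynomial (Fin n × Fin n) ℂ))
    (V : Matrix (Fin r) (Fin m) ℂ) (hA : IsAffine A) (hU : ∀ i k, (U i k).totalDegree ≤ 1)
    (hB : ∀ i j, B i j = ∑ k, U i k * MvPolynomial.C (V k j))
    (hdet : A.det = MvPolynomial.C c)
    (h : perPoly (Fin n) ℂ = MvPolynomial.C α * A.det + MvPolynomial.C β * (A.adjugate * B).trace) :
    HasDetRepr (perPoly (Fin n) ℂ) (m * r + 1) := by
  let Vc : Matrix (Fin r) (Fin m) (MvPolynomial (Fin n × Fin n) ℂ) := fun k j => MvPolynomial.C (V k j)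
  have hVc : ∀ k j, Vc k j = MvPolynomial.C (V k j) := fun _ _ => rfl
  have hBm : B = U * Vc := by
    ext i j
    rw [hB i j, Matrix.mul_apply]
  subst hBm
  rcases Nat.eq_zero_or_pos r with rfl | hr
  · -- `r = 0`: `U V₀ = 0` and `per_n` would be constant
    exfalso
    have hUV : U * Vc = 0 := by
      ext i j
      rw [Matrix.mul_apply]
      simp
    rw [hUV, Matrix.mul_zero, Matrix.trace_zero, mul_zero, add_zero, hdet, ← map_mul] at h
    exact perPoly_ne_C hn _ h
  have hu : IsUnit A.det := by
    rw [hdet]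
    exact (isUnit_iff_ne_zero.mpr hc).map MvPolynomial.C
  let e : Fin (m * r) ≃ Fin m × Fin r := finProdFinEquiv.symm
  refine ⟨border (C (α * c * (c ^ r)⁻¹))
      (fun j => C (-(β * (c ^ (r - 1))⁻¹)) * Vc (e j).2 (e j).1)
      (fun i => U (e i).1 (e i).2)
      ((blockDiagonal fun _ : Fin r => A).submatrix e e), fun i j => ?_, ?_⟩
  · -- affineness
    rcases Fin.eq_zero_or_eq_succ i with rfl | ⟨i', rfl⟩ <;>
      rcases Fin.eq_zero_or_eq_succ j with rfl | ⟨j', rfl⟩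
    · rw [border_zero_zero, totalDegree_C]
      exact Nat.zero_le _
    · rw [border_zero_succ, hVc, ← map_mul, totalDegree_C]
      exact Nat.zero_le _
    · rw [border_succ_zero]
      exact hU _ _
    · rw [border_succ_succ, submatrix_apply, blockDiagonal_apply]
      split_ifs
      · exact hA _ _
      · rw [totalDegree_zero]
        exact Nat.zero_le _
  · -- the determinant
    rw [det_border, border_sum_eq_trace_rank A U Vc _ hu hr,
      det_submatrix_equiv_self, det_blockDiagonal_copies, h, hdet]
    have h1 : C (α * c * (c ^ r)⁻¹) * (C c : MvPolynomial (Fin n × Fin n) ℂ) ^ r = C α * C c := by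
      rw [← map_pow, ← map_mul, ← map_mul]
      congr 1
      field_simp
    have h2 : C (-(β * (c ^ (r - 1))⁻¹)) * (C c : MvPolynomial (Fin n × Fin n) ℂ) ^ (r - 1) =
        -C β := by
      rw [← map_pow, ← map_mul, ← map_neg]
      congr 1
      field_simp
    rw [h1, h2]
    ring

/-- **Mignon–Ressayre after the rank-`r` transfer:** under the hypotheses of
`hasDetRepr_of_dualUnipotentRepr_rank` and `n ≥ 3`, `n² ≤ 2(m·r + 1)`.  Hence `DualUnipotentBound`
holds, with `C = 2r₀ + 2`, on every sub-family of unipotent dual representations whose direction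
`B = U(x)·V₀` has constant row-rank `r ≤ r₀`; the open content of the stub is the regime of
unbounded `r`. [cite: MignonRessayre2004, Thm. 1.1] -/
theorem sq_le_of_dualUnipotentRepr_rank {n m r : ℕ} (hn : 3 ≤ n) (α β c : ℂ) (hc : c ≠ 0)
    (A B : AffMat n m) (U : Matrix (Fin m) (Fin r) (MvPolynomial (Fin n × Fin n) ℂ))
    (V : Matrix (Fin r) (Fin m) ℂ) (hA : IsAffine A) (hU : ∀ i k, (U i k).totalDegree ≤ 1)
    (hB : ∀ i j, B i j = ∑ k, U i k * MvPolynomial.C (V k j))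
    (hdet : A.det = MvPolynomial.C c)
    (h : perPoly (Fin n) ℂ = MvPolynomial.C α * A.det + MvPolynomial.C β * (A.adjugate * B).trace) :
    n ^ 2 ≤ 2 * (m * r + 1) := by
  obtain ⟨k, rfl⟩ : ∃ k, n = k + 3 := ⟨n - 3, by omega⟩
  exact sq_le_two_mul_of_hasDetRepr_perPoly
    (hasDetRepr_of_dualUnipotentRepr_rank (by omega) α β c hc A B U V hA hU hB hdet h)

end Summit.ValiantsHypothesis.ValiantsHypothesis.Cruxes.TwoDimCoefficients.DimTwoCases

end
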